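import Summits.ABC.IUTFork.Repair.RHReachLedgerRealise
import Summits.ABC.IUTFork.Repair.RHReachLedgerBookkeepingRow27
import HarnessLib

/-!
# R-H ROUND 2, row 27 «reach-ledger» (2/2) — THE DOOR `HStarReachLedger ⟹ Cor312.Setting.Statement` at `settingPrVolSharp`, UNCONDITIONAL in (α):
# the ledger's integers are BELOW the surpluses the pooled level weights realise, and the place-currency bookkeeping through abc-iut-rh-typ-10's (β)

PROOF-ONLY file (0 definitions, 0 `Prop` facts; abc-iut cell, D-0079 RESCUE sub-cell R-H, rung LADDER-ABC:A2.RESCUE.H; ROUND-2 seat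
abc-iut-rh2-L1 = row 27's lemma-L1 seat; companion (1/2) = `Repair/RHReachLedgerRealise.lean`, the (α) realisation). TAKES NO SIDE on
[IUTchIII] Cor. 3.12 or on any author; `HStarReachLedger` (abc-iut-lens-nearmiss-1, tree p464022 `Repair.RHReachLedger`) is an R-H CANDIDATE =
a HYPOTHESIS SHAPE, never asserted; typed ≠ proved; instantiated ≠ endorsed; nothing here asserts abc proved or refuted. Inputs BY NAME:
(1/2)'s `levelWeightsAt_reached` / `reachGain_le_cellSlack_of_levelWeightsAt` / `sum_weightPr_mul_apply_last` (p475227), abc-iut-rh-typ-10's (β)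
`RH.ReachLedgerBookkeeping.statement_of_minorant_total_nonneg` (Situation-level generic door), `cellSlack_nonneg_settingPrVolSharp_inl`,
`ledgerSum_eq_sum` (`Repair.RHReachLedgerBookkeeping(Row27)`), abc-iut-c312-7's `finite_primes_under_S`. RELATION TO typ-10's
`statement_settingPrVolSharp_of_hStarReachLedger` (same conclusion): there (α) is a BINDER in abc-iut-w5-d107's BOXED multi-reach shape
(`‖y_a‖ ≤ 1` per slot), which realises only `e − B` per donor slot — short of the ledger's `D = (e−1) + (c−B)` by `(i+1)(c−1)` `w`-units per cell
wherever the inner conductor `c ≥ 2` (HEX `p = 7`, `e_w = l ≥ 11`: `c = 3`); here (α) is DISCHARGED through abc-iut-rp-d3's POOLED level weights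
(p467833), which realise `cellReachSlack + 1` at every cell (§0).

WHAT IS PROVED (numbers, not adjectives).
* §0 integer/real bookkeeping of the ledger: `ledgerSum = Σ_{i<l⋆} cellLevels (i+1)`, `cellLevels ≤ cellReachSlack/e` over `ℝ`,
  `LedgerCell ⟹ 0 ≤ Σ_i cellReachSlack (i+1)` (the floored ledger is a MINORANT of the unfloored one), `rOutSharp ≤ 1 ≤ innerCond`, and the
  key inequality `cellReachSlack p e (i+1) mq + 1 ≤ mq − (i+2)·B − e·⌈((i+1)²·mq − (i+2)(A+e−1))/e⌉` whenever `innerCond p e ≤ A`,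
  `B ≤ rOutSharp p e` (`cellReachSlack_succ_le_realised`): the ledger's per-cell integer is BELOW the surplus the level movers realise.
* §1 (at `settingPrVolSharp`, uniform certified dictionary per prime): `placeSum_le_cellSlack` — `(log p/e_p)·Σ_{v∣p} (n_v/[F:ℚ])·s(p,i,v) ≤ σ_{i+1,p}`
  (the CARD's L1 «surplus `s` ⟹ `σ ≥ s/e` levels», UNFLOORED, weighted by the place weights); **`statement_of_placeLedger`** — if moreover
  `0 ≤ Σ_i s(p,i,w)` at every bad `w` then `Statement`; **`statement_of_hStarReachLedger`** — THE ROW-27 DOOR: with the realising Θ-orders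
  `mΘ = (i+1)²·mq` and certified columns `innerCond ≤ A`, `B ≤ rOutSharp`, `HStarReachLedger ⟹ Statement`.
HONEST SCOPE. «Statement follows from the ledger AS TYPED plus the certified dictionary», nothing more: which genuine data satisfy the ledger
(k1 74.8 % pooled, 98.9 % on frey szpiro-bad∧window — rh-num-1) and whether the certificates `(A, B) = (innerCond, rOutSharp)` hold at a given
field (ties!) is NOT decided here; rh-tst-10's (L1-a) two-sidedness and (L1-c) silent good places are clauses of the theorems, (L1-b) is (1/2)'s
marginal; the generic (β) door is typ-10's. OUR typed objects throughout (Dupuy–Hilado (Ind2) — STRONGER-THAN-PRINT; sharp boxes; hull-level (xi-f)).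
[cite: DupuyHilado2025, §3.6, §3.9, §4.9] [cite: Mochizuki2012, IUTchI Ex. 3.2 (iv) p. 71; IUTchIII Prop. 3.9 (i) p. 116, Rmk. 3.9.3 pp. 119–120,
Cor. 3.12 p. 173–174, Step (xi-f) p. 184] [claim: Mochizuki2012, status: disputed]
-/

noncomputable section

open Set Function
open scoped Pointwise

namespace Summit.ABC.IUTFork.Repair.RH.ReachLedgerDoor

open Cor312 Cor312Vol Literature.IUT.LogThetaLattice Literature.IUT.LogVolume NumberField IsDedekindDomain
  Summit.ABC.IUTFork.Thm311 Summit.ABC.IUTFork.Thm311.Real Summit.ABC.IUTFork.Repair.RH.ReachLedger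
  Summit.ABC.IUTFork.Repair.RH.ReachLedgerRealise Summit.ABC.IUTFork.Repair.RH.ReachLedgerBookkeeping

/-! ## §0. Integer / real bookkeeping of the ledger -/

/-- A floored level is at most the unfloored slack in `p`-level units: `⌊s/e⌋ ≤ s/e` over `ℝ` (`e ≥ 1`). [folklore] -/
theorem cellLevels_cast_le (p e j : ℕ) (he : 1 ≤ e) (mq : ℤ) :
    ((cellLevels p e j mq : ℤ) : ℝ) ≤ (cellReachSlack p e j mq : ℝ) / (e : ℝ) := by
  unfold cellLevels
  have he0 : (0 : ℝ) < e := by exact_mod_cast he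
  rw [le_div_iff₀ he0]
  have hne : ((e : ℕ) : ℤ) ≠ 0 := by exact_mod_cast (show e ≠ 0 by omega)
  exact_mod_cast Int.ediv_mul_le (cellReachSlack p e j mq) hne

/-- **The floored ledger is a minorant of the unfloored one**: `LedgerCell l⋆ p e mq ⟹ 0 ≤ Σ_{i<l⋆} cellReachSlack p e (i+1) mq` (over `ℝ`).
[folklore] -/
theorem sum_cellReachSlack_nonneg_of_ledgerCell {lstar p e : ℕ} (he : 1 ≤ e) {mq : ℤ} (h : LedgerCell lstar p e mq) :
    0 ≤ ∑ i : Fin lstar, (cellReachSlack p e ((i : ℕ) + 1) mq : ℝ) := by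
  unfold LedgerCell at h
  rw [ledgerSum_eq_sum] at h
  have he0 : (0 : ℝ) < e := by exact_mod_cast he
  have h' : (0 : ℝ) ≤ ((∑ i : Fin lstar, cellLevels p e ((i : ℕ) + 1) mq : ℤ) : ℝ) := by exact_mod_cast h
  rw [Int.cast_sum] at h'
  have h'' : (0 : ℝ) ≤ ∑ i : Fin lstar, (cellReachSlack p e ((i : ℕ) + 1) mq : ℝ) / (e : ℝ) :=
    h'.trans (Finset.sum_le_sum fun i _ => cellLevels_cast_le p e _ he mq)
  rw [← Finset.sum_div] at h''
  exact (div_nonneg_iff.mp h'').elim (fun h => h.1) fun h => by linarith [h.2]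

/-- **The ledger's integer is below the realised surplus.** With `A ≥ innerCond p e`, `B ≤ rOutSharp p e`, `e ≥ 1`:
`cellReachSlack p e (i+1) mq + 1 ≤ mq − (i+2)·B − e·⌈((i+1)²·mq − (i+2)·(A + e − 1))/e⌉` (the ceiling written as Lean's `−((−Y)/e)`),
the right side being the `w`-unit surplus the pooled level weights of §2 realise at the cell `(i+1, w)`. [folklore] -/
theorem cellReachSlack_succ_le_realised (p e : ℕ) (he : 1 ≤ e) (A : ℕ) (B : ℤ) (i : ℕ) (mq : ℤ)
    (hA : innerCond p e ≤ (A : ℤ)) (hB : B ≤ rOutSharp p e) :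
    cellReachSlack p e (i + 1) mq + 1 ≤
      mq - ((i : ℤ) + 2) * B -
        (e : ℤ) * (-((-((((i : ℤ) + 1) ^ 2) * mq - ((i : ℤ) + 2) * ((A : ℤ) + e - 1))) / (e : ℤ))) := by
  have h1 := RHLevelMover.mul_neg_ediv_neg_le e he ((((i : ℤ) + 1) ^ 2) * mq - ((i : ℤ) + 2) * ((A : ℤ) + e - 1))
  have hi : (0 : ℤ) ≤ (i : ℤ) + 2 := by positivity
  have h2 : 0 ≤ ((i : ℤ) + 2) * ((A : ℤ) - innerCond p e) := mul_nonneg hi (by linarith)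
  have h3 : 0 ≤ ((i : ℤ) + 2) * (rOutSharp p e - B) := mul_nonneg hi (by linarith)
  unfold cellReachSlack slotReach
  push_cast
  nlinarith [h1, h2, h3]

/-- `r_out♯ ≤ 1`: the `t = 0` term of the minimum is `p⁰ − 0 = 1` (the fold's seed). [folklore] -/
theorem rOutSharp_le_one (p e : ℕ) : rOutSharp p e ≤ 1 := by
  unfold rOutSharp
  suffices h : ∀ (l : List ℤ) (a : ℤ), l.foldl min a ≤ a from h _ 1
  intro l
  induction l with
  | nil => intro a; simp
  | cons x l ih => intro a; rw [List.foldl_cons]; exact (ih _).trans (min_le_left _ _)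

/-- `1 ≤ innerCond p e` for `e ≥ 1` (off the ties `⌊e/(p−1)⌋ + 1 ≥ 1`; on a tie `(p−1) ∣ e` with `e ≥ 1` forces `1 ≤ p − 1 ≤ e`). [folklore] -/
theorem one_le_innerCond (p e : ℕ) (he : 1 ≤ e) : 1 ≤ innerCond p e := by
  unfold innerCond
  split_ifs with h
  · have hp : 0 < p - 1 := by
      rcases Nat.eq_zero_or_pos (p - 1) with h0 | h0
      · rw [h0, zero_dvd_iff] at h; omega
      · exact h0
    have hle : p - 1 ≤ e := Nat.le_of_dvd (by omega) h
    have hdiv : 1 ≤ e / (p - 1) := (Nat.one_le_div_iff hp).mpr hle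
    exact_mod_cast hdiv
  · have h0 : (0 : ℤ) ≤ ((e / (p - 1) : ℕ) : ℤ) := by positivity
    linarith



/-! ## §1. At `settingPrVolSharp`: the place sum, the place-currency door, THE ROW-27 DOOR -/

section Sharp

variable {F : Type} [Field F] [NumberField F] (X : PilotData F) {logv : PadicLogs F} (hlog : LogvAnalytic logv)
  (M : Type) [Field M] [NumberField M]
  (archPk : ∀ (j : (thetaIndex X).Label) (vQ : (thetaIndex X).VQ), Set ((logShellsDH X logv).Packet j vQ))
  (archSub : ∀ (j : (thetaIndex X).Label) (v : (thetaIndex X).V),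
    Set ((logShellsDH X logv).Packet j ((thetaIndex X).over v)))
  (Ψ : ℤ → ∀ v : (thetaIndex X).V, v ∈ (thetaIndex X).Vbad → Set ((logShellsDH X logv).StarPacket v))
  (act : ℤ → ∀ v : (thetaIndex X).V, v ∈ (thetaIndex X).Vbad →
    (logShellsDH X logv).StarPacket v → Module.End ℚ ((logShellsDH X logv).StarPacket v))
  (Mmod : ℤ → ∀ j : (thetaIndex X).LabelStar, Set ((logShellsDH X logv).GlobalPacket j.1))
  (region : ℤ → ∀ j : (thetaIndex X).LabelStar, FinDivisor M → ∀ vQ : (thetaIndex X).VQ,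
    Set ((logShellsDH X logv).Packet j.1 vQ))
  (n : ℤ) {HT : Type} {LogLink : HT → HT → Type} {IsFull : ∀ {s t : HT}, LogLink s t → Prop}
  (lat : LGPGaussianLogThetaLattice LogLink IsFull)
  {Frd : Type} {IsoF : Frd → Frd → Type} {Ob : Frd → Type} {realify : Frd → Frd} {Strip : Type}
  {IsoS : Strip → Strip → Type} {Mv : ∀ v : (thetaIndex X).V, v ∈ (thetaIndex X).Vbad → Type}
  [∀ v h, Monoid (Mv v h)]
  (sig : GlobalLGPFrobenioidSignature (thetaIndex X).lstar (thetaIndex X).V (· ∈ (thetaIndex X).Vbad)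
    Frd IsoF Ob realify Strip IsoS Mv)
  (split : SplittingMonoids Mv) {ObΔ : Type} {N : ∀ v : (thetaIndex X).V, v ∈ (thetaIndex X).Vbad → Type}
  [∀ v h, Monoid (N v h)] (qData : QPilotData ObΔ N)
  (tq : ∀ (pp : Nat.Primes) (x : (thetaIndex X).Fibre (.inr pp)), haveI : Fact (pp : ℕ).Prime := ⟨pp.2⟩; kOf X pp.1 x)
  (t : ∀ (pp : Nat.Primes) (_ : Fin X.lstar) (x : (thetaIndex X).Fibre (.inr pp)),
    haveI : Fact (pp : ℕ).Prime := ⟨pp.2⟩; kOf X pp.1 x)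
  (htq0 : ∀ pp x, tq pp x ≠ 0)
  (htq1 : ∀ (pp : Nat.Primes) (x : (thetaIndex X).Fibre (.inr pp)),
    haveI : Fact (pp : ℕ).Prime := ⟨pp.2⟩; placeOf X pp.1 x ∉ X.S → ‖tq pp x‖ = 1)

section Dictionary

variable (eK AK : Nat.Primes → ℕ) (BK : Nat.Primes → ℤ)
  (ϖ : ∀ (pp : Nat.Primes) (x : (thetaIndex X).Fibre (.inr pp)), haveI : Fact (pp : ℕ).Prime := ⟨pp.2⟩; kOf X pp.1 x)
  (mΘ : ∀ pp : Nat.Primes, Fin (thetaIndex X).lstar → (thetaIndex X).Fibre (.inr pp) → ℤ)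
  (mq : ∀ pp : Nat.Primes, (thetaIndex X).Fibre (.inr pp) → ℤ)
  (s : ∀ pp : Nat.Primes, Fin (thetaIndex X).lstar → (thetaIndex X).Fibre (.inr pp) → ℤ)
/-! ### §1.1 The per-packet bound in PLACE currency: `(log p/e_p)·Σ_{v∣p} (n_v/[F:ℚ])·s(p,i,v) ≤ σ_{i+1,p}` -/

/-- **PLACE SUM ≤ CELL SLACK.** Under the uniform certified dictionary and the surplus bounds of `levelWeightsAt_reached`, at every packet
`(i+1, p)` of `settingPrVolSharp` (bridge hypotheses): `(log p / e_p) · Σ_{v ∣ p} (n_v/[F:ℚ])·s(p,i,v) ≤ σ_{i+1,p} := logvol(ⁿ˒°𝒰_{i+1,p}) − qLocal_{i+1,p}`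
— the reach gain of the idele `t_q·ϖ^{−s}` (`reachGain_le_cellSlack_of_levelWeightsAt`), whose summand `v⃗` contributes
`Pr(v⃗)·(s(v_{i+1})/e_p)·log p`, marginalised over the last slot (`sum_weightPr_mul_apply_last`). This is the CARD's L1 «surplus `s` ⟹ `σ ≥ s/e` levels»
with the levels UNFLOORED and weighted by the place weights. [cite: DupuyHilado2025, §3.6, §3.9, §4.9] [claim: Mochizuki2012, status: disputed] -/
theorem placeSum_le_cellSlack (ht0 : ∀ pp i x, t pp i x ≠ 0) (he : ∀ pp, 1 ≤ eK pp) (hBA : ∀ pp, BK pp ≤ (AK pp : ℤ))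
    (hϖ : ∀ (pp : Nat.Primes) (x : (thetaIndex X).Fibre (.inr pp)), haveI : Fact (pp : ℕ).Prime := ⟨pp.2⟩
      ‖ϖ pp x‖ = ((pp : ℕ) : ℝ) ^ (-(1 : ℝ) / (eK pp : ℝ)))
    (hsharp : ∀ (pp : Nat.Primes) (x : (thetaIndex X).Fibre (.inr pp)), haveI : Fact (pp : ℕ).Prime := ⟨pp.2⟩
      ∃ u : kOf X pp.1 x, ‖u‖ ≤ ‖ϖ pp x‖ ^ ((AK pp : ℤ) - 1) ∧ u ∉ (logUnits (kOf X pp.1 x) : Set (kOf X pp.1 x)))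
    (hrad : ∀ (pp : Nat.Primes) (x : (thetaIndex X).Fibre (.inr pp)), haveI : Fact (pp : ℕ).Prime := ⟨pp.2⟩
      ∃ z ∈ (logUnits (kOf X pp.1 x) : Set (kOf X pp.1 x)), ((pp : ℕ) : ℝ) ^ (-(BK pp : ℝ) / (eK pp : ℝ)) ≤ ‖z‖)
    (ht1 : ∀ (pp : Nat.Primes) (i : Fin X.lstar) (x : (thetaIndex X).Fibre (.inr pp)),
      haveI : Fact (pp : ℕ).Prime := ⟨pp.2⟩; placeOf X pp.1 x ∉ X.S → ‖t pp i x‖ = 1)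
    (hΘ : ∀ (pp : Nat.Primes) (i : Fin X.lstar) (w : (thetaIndex X).Fibre (.inr pp)), haveI : Fact (pp : ℕ).Prime := ⟨pp.2⟩
      placeOf X pp.1 w ∈ X.S → ‖t pp i w‖ = ‖ϖ pp w‖ ^ (mΘ pp i w))
    (hq : ∀ (pp : Nat.Primes) (w : (thetaIndex X).Fibre (.inr pp)), haveI : Fact (pp : ℕ).Prime := ⟨pp.2⟩
      placeOf X pp.1 w ∈ X.S → ‖tq pp w‖ = ‖ϖ pp w‖ ^ (mq pp w))
    (hs0 : ∀ (pp : Nat.Primes) (i : Fin (thetaIndex X).lstar) (x : (thetaIndex X).Fibre (.inr pp)),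
      haveI : Fact (pp : ℕ).Prime := ⟨pp.2⟩; placeOf X pp.1 x ∉ X.S → s pp i x = 0)
    (hs : ∀ (pp : Nat.Primes) (i : Fin (thetaIndex X).lstar) (w : (thetaIndex X).Fibre (.inr pp)),
      haveI : Fact (pp : ℕ).Prime := ⟨pp.2⟩; placeOf X pp.1 w ∈ X.S →
        s pp i w ≤ mq pp w - ((i : ℤ) + 2) * BK pp -
          (eK pp : ℤ) * (-((-(mΘ pp i w - ((i : ℤ) + 2) * ((AK pp : ℤ) + eK pp - 1))) / (eK pp : ℤ))))
    (HB : BridgeHyps (settingPrVolSharp X hlog M archPk archSub Ψ act Mmod region n lat sig split qData tq t htq0 htq1)) (pp : Nat.Primes) (i : Fin (thetaIndex X).lstar) :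
    haveI : Fact (pp : ℕ).Prime := ⟨pp.2⟩
    Real.log ((pp : ℕ) : ℝ) / (eK pp : ℝ) *
        ∑ v : ↥(placesOver F pp), weight F v.1 * (s pp i ((fibreEquivPlacesOver X pp).symm v) : ℝ) ≤
      ((situationPrVol X hlog M archPk archSub Ψ act Mmod region).D n).logvol (Setting.labelSucc i) (.inr pp)
          ((settingPrVolSharp X hlog M archPk archSub Ψ act Mmod region n lat sig split qData tq t htq0 htq1).thetaHull (Setting.labelSucc i) (.inr pp)) -
        (settingPrVolSharp X hlog M archPk archSub Ψ act Mmod region n lat sig split qData tq t htq0 htq1).qLocal (Setting.labelSucc i) (.inr pp) := by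
  haveI : Fact (pp : ℕ).Prime := ⟨pp.2⟩
  have hp0 : (0 : ℝ) < (pp : ℕ) := by exact_mod_cast pp.2.pos
  have hgain := reachGain_le_cellSlack_of_levelWeightsAt X hlog M archPk archSub Ψ act Mmod region n lat sig split qData tq t htq0 htq1
    ht0 pp i (fun pp x => tq pp x * ϖ pp x ^ (-(s pp i x))) (reached_ne_zero X tq htq0 eK ϖ s hϖ i)
    (norm_reached_eq_one_of_good X tq htq1 ϖ s hs0 i)
    (fun e => levelWeightsAt_reached X tq t htq1 eK AK BK ϖ mΘ mq s he hBA hϖ hsharp hrad ht1 hΘ hq hs0 hs pp i e) HB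
  -- per summand the gain is `(s(v_{i+1})/e_p)·log p`
  have hterm : ∀ e : (presAt X hlog pp).toLocalPieces.E (Setting.labelSucc i),
      weightPr X pp.1 (Setting.labelSucc i) e *
          (Real.log ‖tq pp (e (Fin.last _)) * ϖ pp (e (Fin.last _)) ^ (-(s pp i (e (Fin.last _))))‖ -
            Real.log ‖tq pp (e (Fin.last _))‖) =
        Real.log ((pp : ℕ) : ℝ) / (eK pp : ℝ) * (weightPr X pp.1 (Setting.labelSucc i) e * (s pp i (e (Fin.last _)) : ℝ)) := by
    intro e
    have htqpos : 0 < ‖tq pp (e (Fin.last _))‖ := norm_pos_iff.mpr (htq0 pp _)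
    have hϖpow : ‖ϖ pp (e (Fin.last _)) ^ (-(s pp i (e (Fin.last _))))‖ =
        ((pp : ℕ) : ℝ) ^ ((s pp i (e (Fin.last _)) : ℝ) / (eK pp : ℝ)) := by
      rw [norm_zpow, norm_varpi_zpow X eK ϖ pp (hϖ pp) (e (Fin.last _))]
      congr 1
      push_cast
      ring
    rw [norm_mul, hϖpow, Real.log_mul htqpos.ne' (Real.rpow_pos_of_pos hp0 _).ne', Real.log_rpow hp0]
    ring
  rw [Finset.sum_congr rfl fun e _ => hterm e, ← Finset.mul_sum,
    sum_weightPr_mul_apply_last X hlog pp (Setting.labelSucc i) (fun x => (s pp i x : ℝ))] at hgain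
  exact hgain

/-! ### §1.2 THE DOOR in place currency: a nonnegative per-place label sum gives the Statement -/

/-- **ROW 27's DOOR, PLACE CURRENCY.** At `settingPrVolSharp` (bridge hypotheses), uniform certified dictionary per prime
as in `levelWeightsAt_reached`; integers `s(p,i,x)` vanishing off `S` and realisable at the bad places
(`s ≤ mq − (i+2)·B − e·⌈(mΘ − (i+2)(A+e−1))/e⌉`). IF at every bad place `w` the LABEL SUM is nonnegative, `0 ≤ Σ_{i<l⋆} s(p,i,w)` — low-label
surplus may pay for top-label DEFICIT (two-sided, rh-tst-10's (L1-a)) — THEN the typed Corollary `Statement` holds: §2.4 cell by cell, the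
last-slot weights `n_w/[F:ℚ] ≥ 0` do not read the label ((L1-b)), good places are silent ((L1-c)), and abc-iut-rh-typ-10's generic (β) door
`statement_of_minorant_total_nonneg`. «Statement follows from the surpluses AS TYPED», nothing more. [cite: Mochizuki2012, IUTchIII Prop. 3.9 (i) p. 116, Rmk. 3.9.3, Cor. 3.12 p. 173–174] [claim: Mochizuki2012, status: disputed] -/
theorem statement_of_placeLedger (ht0 : ∀ pp i x, t pp i x ≠ 0) (he : ∀ pp, 1 ≤ eK pp) (hBA : ∀ pp, BK pp ≤ (AK pp : ℤ))
    (hϖ : ∀ (pp : Nat.Primes) (x : (thetaIndex X).Fibre (.inr pp)), haveI : Fact (pp : ℕ).Prime := ⟨pp.2⟩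
      ‖ϖ pp x‖ = ((pp : ℕ) : ℝ) ^ (-(1 : ℝ) / (eK pp : ℝ)))
    (hsharp : ∀ (pp : Nat.Primes) (x : (thetaIndex X).Fibre (.inr pp)), haveI : Fact (pp : ℕ).Prime := ⟨pp.2⟩
      ∃ u : kOf X pp.1 x, ‖u‖ ≤ ‖ϖ pp x‖ ^ ((AK pp : ℤ) - 1) ∧ u ∉ (logUnits (kOf X pp.1 x) : Set (kOf X pp.1 x)))
    (hrad : ∀ (pp : Nat.Primes) (x : (thetaIndex X).Fibre (.inr pp)), haveI : Fact (pp : ℕ).Prime := ⟨pp.2⟩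
      ∃ z ∈ (logUnits (kOf X pp.1 x) : Set (kOf X pp.1 x)), ((pp : ℕ) : ℝ) ^ (-(BK pp : ℝ) / (eK pp : ℝ)) ≤ ‖z‖)
    (ht1 : ∀ (pp : Nat.Primes) (i : Fin X.lstar) (x : (thetaIndex X).Fibre (.inr pp)),
      haveI : Fact (pp : ℕ).Prime := ⟨pp.2⟩; placeOf X pp.1 x ∉ X.S → ‖t pp i x‖ = 1)
    (hΘ : ∀ (pp : Nat.Primes) (i : Fin X.lstar) (w : (thetaIndex X).Fibre (.inr pp)), haveI : Fact (pp : ℕ).Prime := ⟨pp.2⟩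
      placeOf X pp.1 w ∈ X.S → ‖t pp i w‖ = ‖ϖ pp w‖ ^ (mΘ pp i w))
    (hq : ∀ (pp : Nat.Primes) (w : (thetaIndex X).Fibre (.inr pp)), haveI : Fact (pp : ℕ).Prime := ⟨pp.2⟩
      placeOf X pp.1 w ∈ X.S → ‖tq pp w‖ = ‖ϖ pp w‖ ^ (mq pp w))
    (hs0 : ∀ (pp : Nat.Primes) (i : Fin (thetaIndex X).lstar) (x : (thetaIndex X).Fibre (.inr pp)),
      haveI : Fact (pp : ℕ).Prime := ⟨pp.2⟩; placeOf X pp.1 x ∉ X.S → s pp i x = 0)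
    (hs : ∀ (pp : Nat.Primes) (i : Fin (thetaIndex X).lstar) (w : (thetaIndex X).Fibre (.inr pp)),
      haveI : Fact (pp : ℕ).Prime := ⟨pp.2⟩; placeOf X pp.1 w ∈ X.S →
        s pp i w ≤ mq pp w - ((i : ℤ) + 2) * BK pp -
          (eK pp : ℤ) * (-((-(mΘ pp i w - ((i : ℤ) + 2) * ((AK pp : ℤ) + eK pp - 1))) / (eK pp : ℤ))))
    (hled : ∀ (pp : Nat.Primes) (w : (thetaIndex X).Fibre (.inr pp)), haveI : Fact (pp : ℕ).Prime := ⟨pp.2⟩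
      placeOf X pp.1 w ∈ X.S → 0 ≤ ∑ i : Fin (thetaIndex X).lstar, (s pp i w : ℝ))
    (HB : BridgeHyps (settingPrVolSharp X hlog M archPk archSub Ψ act Mmod region n lat sig split qData tq t htq0 htq1)) :
    (settingPrVolSharp X hlog M archPk archSub Ψ act Mmod region n lat sig split qData tq t htq0 htq1).Statement := by
  haveI hF : ∀ pp : Nat.Primes, Fact (pp : ℕ).Prime := fun pp => ⟨pp.2⟩
  classical
  -- the per-packet lower bounds (`0` at the archimedean packets)
  let b : Fin (thetaIndex X).lstar → (thetaIndex X).VQ → ℝ := fun i vQ =>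
    Sum.elim (fun _ => (0 : ℝ)) (fun pp : Nat.Primes =>
      Real.log ((pp : ℕ) : ℝ) / (eK pp : ℝ) *
        ∑ v : ↥(placesOver F pp), weight F v.1 * (s pp i ((fibreEquivPlacesOver X pp).symm v) : ℝ)) vQ
  set U : Finset Nat.Primes := (finite_primes_under_S X).toFinset with hU
  -- a prime with no bad place contributes nothing (the surpluses vanish off `S`)
  have hzero : ∀ (i : Fin (thetaIndex X).lstar) (pp : Nat.Primes), pp ∉ U → b i (.inr pp) = 0 := by
    intro i pp hpp
    have hgood : ∀ x : (thetaIndex X).Fibre (.inr pp), placeOf X pp.1 x ∉ X.S := fun x hx =>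
      hpp ((finite_primes_under_S X).mem_toFinset.mpr ⟨_, hx, natCast_mem_placeOf X pp.1 x⟩)
    show Real.log ((pp : ℕ) : ℝ) / (eK pp : ℝ) *
      ∑ v : ↥(placesOver F pp), weight F v.1 * (s pp i ((fibreEquivPlacesOver X pp).symm v) : ℝ) = 0
    rw [Finset.sum_eq_zero fun v _ => by rw [hs0 pp i _ (hgood _), Int.cast_zero, mul_zero], mul_zero]
  have hsupp : ∀ i, Function.support (b i) ⊆ ↑(U.image Sum.inr : Finset (thetaIndex X).VQ) := by
    intro i vQ hvQ
    rw [Function.mem_support] at hvQ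
    rw [Finset.mem_coe]
    cases vQ with
    | inl u => exact (hvQ rfl).elim
    | inr pp =>
      by_contra hmem
      exact hvQ (hzero i pp fun hpp => hmem (Finset.mem_image.mpr ⟨pp, hpp, rfl⟩))
  have hbfin : ∀ i, (Function.support (b i)).Finite := fun i => (Finset.finite_toSet _).subset (hsupp i)
  refine statement_of_minorant_total_nonneg
    (P := settingPrVolSharp X hlog M archPk archSub Ψ act Mmod region n lat sig split qData tq t htq0 htq1) HB.finite b hbfin ?_ ?_
  · -- the cell bounds: free at the archimedean packets (typ-10), §1.1 at the primes
    intro i vQ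
    cases vQ with
    | inl u =>
      exact cellSlack_nonneg_settingPrVolSharp_inl X hlog M archPk archSub Ψ act Mmod region n lat sig split qData tq t htq0 htq1 HB.mono
        HB.finite i u
    | inr pp =>
      exact placeSum_le_cellSlack X hlog M archPk archSub Ψ act Mmod region n lat sig split qData tq t htq0 htq1 eK AK BK ϖ mΘ mq s
        ht0 he hBA hϖ hsharp hrad ht1 hΘ hq hs0 hs HB pp i
  · -- the total: swap labels and places — the place weights do not read the label
    have hfs : ∀ i, ∑ᶠ vQ, b i vQ = ∑ pp ∈ U, b i (.inr pp) := by
      intro i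
      rw [finsum_eq_sum_of_support_subset (b i) (hsupp i)]
      exact Finset.sum_image fun x _ y _ h => Sum.inr_injective h
    rw [Finset.sum_congr rfl fun i _ => hfs i, Finset.sum_comm]
    refine Finset.sum_nonneg fun pp _ => ?_
    show (0 : ℝ) ≤ ∑ i : Fin (thetaIndex X).lstar, Real.log ((pp : ℕ) : ℝ) / (eK pp : ℝ) *
      ∑ v : ↥(placesOver F pp), weight F v.1 * (s pp i ((fibreEquivPlacesOver X pp).symm v) : ℝ)
    rw [← Finset.mul_sum, Finset.sum_comm]
    refine mul_nonneg (div_nonneg (Real.log_nonneg (by exact_mod_cast pp.2.one_lt.le)) (by positivity))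
      (Finset.sum_nonneg fun v _ => ?_)
    rw [← Finset.mul_sum]
    refine mul_nonneg (weight_nonneg F _) ?_
    by_cases hbad : placeOf X pp.1 ((fibreEquivPlacesOver X pp).symm v) ∈ X.S
    · exact hled pp _ hbad
    · exact (Finset.sum_eq_zero fun i _ => by rw [hs0 pp i _ hbad, Int.cast_zero]).ge

/-! ### §1.3 THE ROW-27 DOOR: `HStarReachLedger ⟹ Statement` (realising Θ-orders, certified columns) -/

open scoped Classical in
/-- **THE ROW-27 DOOR — `HStarReachLedger ⟹ Cor312.Setting.Statement` at `settingPrVolSharp`.** Bridge hypotheses (abc-iut-c312-7's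
`bridgeHyps_settingPrVolSharp` from `ThetaFinite`); uniform certified dictionary per prime (`e_p ≥ 1`, norm uniformizers, an inner certificate `A_p` = a NON-log-unit of valuation `≥ A_p − 1` at every `x ∣ p`, an outer
certificate `B_p` = a log-unit of norm `≥ p^{−B_p/e_p}` — `B_p ≤ rOutSharp ≤ 1 ≤ innerCond ≤ A_p`, §0; for the column values `(A, B) = (innerCond, rOutSharp)` these are
`RHSlotReach.exists_hsharp_one`/row 20's `isInnerConductor_of_not_dvd` and `RHSlotReach.exists_hrad_sharp` off the ties — NOT supplied here);
REALISING Θ-orders `mΘ = (i+1)²·mq` at the bad places ([IUTchI] Ex. 3.2 (iv)); the ledger's columns DOMINATED by the certificates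
(`innerCond p e_p ≤ A_p`, `B_p ≤ rOutSharp p e_p`) and its ramification datum `e_w = e_p`. THEN abc-iut-lens-nearmiss-1's candidate
`HStarReachLedger l⋆ Fib bad e mq` (every bad place: `0 ≤ Σ_j ⌊cellReachSlack_j/e⌋`) implies the typed Corollary: the floored ledger is a
minorant of `Σ_j cellReachSlack_j` (§0), each `cellReachSlack_j + 1` is REALISED by the pooled level weights (§0 and (1/2) `levelWeightsAt_reached`),
and `statement_of_placeLedger`. Same conclusion as abc-iut-rh-typ-10's `statement_settingPrVolSharp_of_hStarReachLedger`, WITHOUT its (α) binders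
`tq'`/`hreal`/`hreach` (there in the boxed shape, which under-realises the ledger at every place with inner conductor `≥ 2`). This closes
row 27's k2 route «H⋆₂₇ ⟹ Statement» (door (b) of CARD-reach-ledger.md) as a theorem about a HYPOTHESIS; which genuine data satisfy H⋆₂₇
(k1: 74.8 % pooled, 98.9 % on frey szpiro-bad∧window) is rh-num-1's table, not this file. [cite: Mochizuki2012, IUTchI Ex. 3.2 (iv) p. 71;
IUTchIII Rmk. 3.9.3 pp. 119–120, Cor. 3.12 p. 173–174] [cite: DupuyHilado2025, §3.6, §3.9, §4.9] [claim: Mochizuki2012, status: disputed] -/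
theorem statement_of_hStarReachLedger (ht0 : ∀ pp i x, t pp i x ≠ 0) (he : ∀ pp, 1 ≤ eK pp)
    (hϖ : ∀ (pp : Nat.Primes) (x : (thetaIndex X).Fibre (.inr pp)), haveI : Fact (pp : ℕ).Prime := ⟨pp.2⟩
      ‖ϖ pp x‖ = ((pp : ℕ) : ℝ) ^ (-(1 : ℝ) / (eK pp : ℝ)))
    (hsharp : ∀ (pp : Nat.Primes) (x : (thetaIndex X).Fibre (.inr pp)), haveI : Fact (pp : ℕ).Prime := ⟨pp.2⟩
      ∃ u : kOf X pp.1 x, ‖u‖ ≤ ‖ϖ pp x‖ ^ ((AK pp : ℤ) - 1) ∧ u ∉ (logUnits (kOf X pp.1 x) : Set (kOf X pp.1 x)))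
    (hrad : ∀ (pp : Nat.Primes) (x : (thetaIndex X).Fibre (.inr pp)), haveI : Fact (pp : ℕ).Prime := ⟨pp.2⟩
      ∃ z ∈ (logUnits (kOf X pp.1 x) : Set (kOf X pp.1 x)), ((pp : ℕ) : ℝ) ^ (-(BK pp : ℝ) / (eK pp : ℝ)) ≤ ‖z‖)
    (ht1 : ∀ (pp : Nat.Primes) (i : Fin X.lstar) (x : (thetaIndex X).Fibre (.inr pp)),
      haveI : Fact (pp : ℕ).Prime := ⟨pp.2⟩; placeOf X pp.1 x ∉ X.S → ‖t pp i x‖ = 1)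
    (hΘ : ∀ (pp : Nat.Primes) (i : Fin X.lstar) (w : (thetaIndex X).Fibre (.inr pp)), haveI : Fact (pp : ℕ).Prime := ⟨pp.2⟩
      placeOf X pp.1 w ∈ X.S → ‖t pp i w‖ = ‖ϖ pp w‖ ^ (mΘ pp i w))
    (hq : ∀ (pp : Nat.Primes) (w : (thetaIndex X).Fibre (.inr pp)), haveI : Fact (pp : ℕ).Prime := ⟨pp.2⟩
      placeOf X pp.1 w ∈ X.S → ‖tq pp w‖ = ‖ϖ pp w‖ ^ (mq pp w))
    (eL : ∀ pp : Nat.Primes, (thetaIndex X).Fibre (.inr pp) → ℕ) (heL : ∀ pp x, eL pp x = eK pp)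
    (hA : ∀ pp : Nat.Primes, innerCond pp (eK pp) ≤ (AK pp : ℤ)) (hB : ∀ pp : Nat.Primes, BK pp ≤ rOutSharp pp (eK pp))
    (hmΘ : ∀ (pp : Nat.Primes) (i : Fin (thetaIndex X).lstar) (w : (thetaIndex X).Fibre (.inr pp)),
      haveI : Fact (pp : ℕ).Prime := ⟨pp.2⟩; placeOf X pp.1 w ∈ X.S → mΘ pp i w = (((i : ℕ) : ℤ) + 1) ^ 2 * mq pp w)
    (hH : HStarReachLedger (thetaIndex X).lstar (fun pp => (thetaIndex X).Fibre (.inr pp))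
      (fun pp w => haveI : Fact (pp : ℕ).Prime := ⟨pp.2⟩; placeOf X pp.1 w ∈ X.S) eL mq)
    (HB : BridgeHyps (settingPrVolSharp X hlog M archPk archSub Ψ act Mmod region n lat sig split qData tq t htq0 htq1)) :
    (settingPrVolSharp X hlog M archPk archSub Ψ act Mmod region n lat sig split qData tq t htq0 htq1).Statement :=
  statement_of_placeLedger X hlog M archPk archSub Ψ act Mmod region n lat sig split qData tq t htq0 htq1 eK AK BK ϖ mΘ mq
    (fun pp i x => haveI : Fact (pp : ℕ).Prime := ⟨pp.2⟩
      if placeOf X pp.1 x ∈ X.S then cellReachSlack pp (eK pp) ((i : ℕ) + 1) (mq pp x) else 0)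
    ht0 he (fun pp => (hB pp).trans ((rOutSharp_le_one _ _).trans ((one_le_innerCond _ _ (he pp)).trans (hA pp))))
    hϖ hsharp hrad ht1 hΘ hq
    (fun pp i x hx => if_neg hx)
    (fun pp i w hw => by
      have h := cellReachSlack_succ_le_realised pp (eK pp) (he pp) (AK pp) (BK pp) i (mq pp w) (hA pp) (hB pp)
      rw [if_pos hw, hmΘ pp i w hw]
      linarith [h])
    (fun pp w hw => by
      have hcell : LedgerCell (thetaIndex X).lstar pp (eK pp) (mq pp w) := by rw [← heL pp w]; exact hH pp w hw
      have h := sum_cellReachSlack_nonneg_of_ledgerCell (he pp) hcell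
      simpa only [if_pos hw] using h)
    HB

end Dictionary

end Sharp

end Summit.ABC.IUTFork.Repair.RH.ReachLedgerDoor

end
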